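import Summits.HodgeConjecture.HodgeConjecture.Theorems.MarkmanPartnerTransportPicardThreeK3SquaresNSAbsorption
import Summits.HodgeConjecture.HodgeConjecture.Theorems.MarkmanPartnerTransportPicardThreeK3SquaresRealMultiplicationRanksCorollaries
import Literature.AlgebraicGeometry.HodgeTheory.DominatedByPowersHodgeConjecture

/-!
# Route MarkmanPartnerTransport · crux `PicardThreeK3Squares` (stmt-HodgeConjecture-19652) —
# «NL-ASCENT»: modulo Buskin, markings and the DISPLAYED Noether–Lefschetz ascent families, the crux is
# the Hodge conjecture for the squares of the non-CM, non-scalar projective K3 surfaces with ρ ∈ {4, 6, 7}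

Sequel to `…VeryGeneralSpread` (p710538) and `…NSAbsorption`. The cell's residue table for the crux (rows
RM-ranks / RM-residue-v33 of the index) lists the real-multiplication Picard numbers
`ρ(S) ∈ {4, 6, 7, 8, 10, 12, 13, 14, 16}` as open. The NOETHER–LEFSCHETZ ASCENT (memo NL-ASCENT.md,
evidence #53 on the item) observes that a K3 surface `S` with real multiplication by `E`, `[E:ℚ] = d`,
`ρ(S) ≥ d + 4`, is a special member of a real-multiplication family of Picard number `ρ(S) − d` through
it (an `E`-trace form `N₀ ⊂ h^⊥ ⊂ NS(S)_ℚ` exists by Hasse–Minkowski in codimension ≥ 3, O'Meara 63:21 /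
66:3; the `E`-eigenperiod domain of `T(S)_ℚ ⊕ N₀` has dimension `m − 1` and passes through the period of
`S`, van Geemen–Schütt §2.6 / Prop. 3.2; its very general member has `NS = N₀^⊥ ∩ NS(S)_ℚ` and `End = E`),
along which the generator class is flat, rational and Hodge, and restricts at `S ⊗ S` to «generator +
NS-supported». Since every real-multiplication type with `ρ ≥ 8` has `ρ ≥ d + 4`, and the fibres of the
ascent family are K3 squares of Picard number `ρ − d ∈ [4, ρ)`, a strong induction on `ρ` with the
consumer `NSAbsorption.hodgeConjectureFor_square_of_residual_hodgeConjectureFor_of_section` collapses the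
open list to `ρ ∈ {4, 6, 7}`:

* `hodgeConjectureFor_square_of_nlAscent` — for every projective K3 surface `S` with `ρ(S) ≥ 3`,
  `HodgeConjectureFor 4 (S ⊗ S)`, GRANTED (i) `Buskin2019_hodgeIsometry_algebraic`, (ii)
  `Huybrechts_K3_marking_exists`, (iii) the DISPLAYED ascent families `hAsc` — for every non-CM,
  non-scalar K3 surface in the real-multiplication ranks with `ρ(S) ≥ 8`: a rational `t` killing `N¹`
  generating the rational Hodge endomorphisms of `T(S)`, an NS-supported `f`, a smooth projective family
  through `S ⊗ S ≅ 𝒳_{b₁}` over a smooth irreducible quasi-projective base with a continuous section of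
  `R⁴` inducing `t + f` at `b₁`, whose values over a RESIDUAL set of `b` are rational `(2,2)`-classes on
  fibres isomorphic to squares `S' ⊗ S'` of K3 surfaces with `3 ≤ ρ(S') < ρ(S)` (a theorem of
  Hodge/moduli theory — the universal family over the real-multiplication component, NOT constructed in
  the tree: moduli input (I1′)), and (iv) `hTerm` — HC⁴(`S ⊗ S`) for the non-CM, non-scalar K3 surfaces
  with `ρ(S) ∈ {4, 6, 7}` (the five terminal types `(ρ,d,m) ∈ {(4,2,9),(4,3,6),(6,4,4),(7,5,3),(4,6,3)}`
  and the two ascendable types `(6,2,8)`, `(7,3,5)` — OPEN);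
* `picardThreeK3Squares_of_nlAscent` — **the crux `PicardThreeK3Squares` under the same four
  hypotheses**: modulo Buskin, markings and the displayed ascent families, the open content of crux #4
  is EXACTLY the Hodge conjecture for the squares of the real-multiplication K3 surfaces of Picard
  number 4, 6 or 7.
* `four_add_le_or_terminal` — the arithmetic of the ascent: a real-multiplication type `(ρ, d, m)` with
  `ρ ≥ 3` has `ρ ≥ d + 4` unless `(ρ, d) ∈ {(4,2), (4,3), (6,4), (7,5), (4,6)}`.
* `hodgeConjectureFor_square_of_nlAscent_terminal`, `picardThreeK3Squares_of_nlAscent_terminal` — the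
  SHARP form: with the ascent families displayed for every non-terminal real-multiplication K3 surface
  (`ρ ≥ [E:ℚ] + 4`, the field degree read off an irreducible annihilating polynomial of a generator),
  the crux follows from HC⁴ for the squares of the K3 surfaces of the five TERMINAL types
  `(4,2,9), (4,3,6), (6,4,4), (7,5,3), (4,6,3)` alone.

Bookkeeping used: off the real-multiplication ranks `hodgeConjectureFor_square_of_forall_mul_add_ne`
(RealMultiplicationRanks: `E = ℚ` kernel theorem or Buskin's CM third); `ρ ∈ {3, 5}` are not
real-multiplication ranks (`mul_add_ne_of_lt_six_or_prime`); transport of `HodgeConjectureFor` along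
`𝒳_b ≅ S' ⊗ S'` (`hodgeConjectureFor_iff_of_iso'`). No definition, no sorry; named facts and the
displayed families are hypotheses. Prover seat hodge-nonav-19652-p1 (gen 18),
`--supports stmt-HodgeConjecture-19652`. Nothing here proves the crux or any instance of HC.

References: van Geemen–Schütt, Forum Math. Sigma 13 (2025) e2, §2.5–2.6, Prop. 3.2, §3.4, §6.6;
van Geemen, Michigan Math. J. 56 (2008) Lemma 3.2; Voisin, *Hodge Theory II*, §3.3.1, §5.3.4, §7.3.2,
Thm. 4.18; Charles–Schnell (2014) Prop. 11.3.11; O'Meara, *Introduction to Quadratic Forms*, 63:21, 66:3;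
Cattani–Deligne–Kaplan, JAMS 8 (1995) Cor. 1.2; Buskin, J. reine angew. Math. 755 (2019) Thm. 1.1;
Varesco, Math. Z. 305 (2023) §2.
-/

set_option linter.dupNamespace false

noncomputable section

namespace Summit.HodgeConjecture.HodgeConjecture.Theorems.MarkmanPartnerTransport.NLAscent

open CategoryTheory MonoidalCategory CartesianMonoidalCategory AlgebraicGeometry Polynomial
open Literature.AlgebraicGeometry Literature.AlgebraicGeometry.Motives Literature.AlgebraicGeometry.HodgeTheory
open Literature.AlgebraicGeometry.Surfaces
open Literature.AlgebraicTopology.SingularHomology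
open Summit.HodgeConjecture.HodgeConjecture.Theorems
open Summit.HodgeConjecture.HodgeConjecture.Theorems.NikulinTwinTransport
open Summit.HodgeConjecture.HodgeConjecture.Theorems.MarkmanPartnerTransport.RealMultiplicationRanks

variable {S : SchemeOver ℂ}

/-- `Corr[μ, hS ; γ, y] = fst_*(snd^* y ∪ γ)` on `H²(S(ℂ); ℂ)`. Local notation only. -/
local notation3 (prettyPrint := false) "Corr[" μ ", " hS " ; " γ ", " y "]" =>
  complexGysin μ (IsSmoothProjective.tensor_holds hS hS) hS
    (SemiCartesianMonoidalCategory.fst _ _) (rfl : 2 * 1 + 2 * 2 + 2 * 2 = 2 * 1 + 2 * (2 + 2))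
    (cupProduct (rfl : 2 * 1 + 2 * 2 = 2 * 1 + 2 * 2)
      (complexBetti.map (SemiCartesianMonoidalCategory.snd _ _) (2 * 1) y) γ)

/-- `Scalar[S]`: «`End_Hdg(T(S)) = ℚ`» — every rational Hodge endomorphism of `H²(S(ℂ); ℂ)` killing
`N¹` with image cup-orthogonal to `N¹` is a rational scalar on `T = (N¹)^⊥` (VERBATIM the scalar clause
of `RealMultiplicationRanks.picardThreeK3Squares_of_realMultiplicationRanks`). Local notation only. -/
local notation3 (prettyPrint := false) "Scalar[" S "]" =>
  (∀ (f : complexBetti S (2 * 1) →ₗ[ℂ] complexBetti S (2 * 1)),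
    (∀ y, IsRationalClass y → IsRationalClass (f y)) →
    (∀ (i j : ℕ) y, IsOfHodgeType 2 S (2 * 1) i j y → IsOfHodgeType 2 S (2 * 1) i j (f y)) →
    (∀ d ∈ algebraicClasses S 1, f d = 0) →
    (∀ y : complexBetti S (2 * 1), ∀ d ∈ algebraicClasses S 1,
      cupProduct (rfl : 2 * 1 + 2 * 1 = 2 * 2) (f y) d = 0) →
    ∃ a : ℚ, ∀ y : complexBetti S (2 * 1),
      (∀ d ∈ algebraicClasses S 1, cupProduct (rfl : 2 * 1 + 2 * 1 = 2 * 2) y d = 0) →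
        f y = (a : ℂ) • y)

/-- `NLAscentFamily[S, hS]`: **the displayed Noether–Lefschetz ascent family through `S ⊗ S`** — a
rational `t` killing `N¹` with `TranscendentalEndomorphismsGeneratedBy S t`, an NS-supported `f`, a smooth
projective family `g : 𝒳 → B` (quasi-projective total space; smooth, irreducible, quasi-projective base)
of relative dimension `4`, a continuous section `σ` of `FiberClass g 4`, a point `b₁` with
`S ⊗ S ≅ 𝒳_{b₁}` at which the value of `σ` induces `t + f`, such that for a RESIDUAL set of `b ∈ B(ℂ)` the
value of `σ` is a rational class of type `(2,2)` and the fibre is isomorphic to the square `S' ⊗ S'` of a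
K3 surface with `3 ≤ ρ(S') < ρ(S)`. Local notation only (an `∃`-statement, not a definition).
[cite: GeemenSchutt2023, §2.6 and Prop. 3.2] [cite: VoisinHodgeII2003, §5.3.4 and §7.3.2] -/
local notation3 (prettyPrint := false) "NLAscentFamily[" S ", " hS "]" =>
  (∃ (t f : complexBetti S (2 * 1) →ₗ[ℂ] complexBetti S (2 * 1)),
    (∀ y, IsRationalClass y → IsRationalClass (t y)) ∧
    (∀ d ∈ algebraicClasses S 1, t d = 0) ∧
    TranscendentalEndomorphismsGeneratedBy S t ∧
    (∀ y, f y ∈ algebraicClasses S 1) ∧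
    (∀ y : complexBetti S (2 * 1),
      (∀ d ∈ algebraicClasses S 1, cupProduct (rfl : 2 * 1 + 2 * 1 = 2 * 2) y d = 0) → f y = 0) ∧
    ∃ (𝒳 B : SchemeOver ℂ) (g : 𝒳 ⟶ B),
      IsSmoothProjectiveFamily g 4 ∧ IsQuasiProjectiveOver 𝒳 ∧ IsQuasiProjectiveOver B ∧
      AlgebraicGeometry.Smooth B.hom ∧ IrreducibleSpace B.left ∧
      ∃ (σ : ComplexPoints B → FiberClass g (2 * 2)) (hpt : ∀ b, (σ b).pt = b), Continuous σ ∧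
      ∃ (b₁ : ComplexPoints B) (e₁ : S ⊗ S ≅ fiberOver g b₁),
        (∀ y : complexBetti S (2 * 1),
          t y + f y = Corr[complexOrientationFamily, hS ;
            complexBetti.map e₁.hom (2 * 2) ((σ b₁).clsAt (hpt b₁)), y]) ∧
        ∀ᶠ b in residual (ComplexPoints B),
          IsRationalClass ((σ b).clsAt (hpt b)) ∧
          IsOfHodgeType 4 (fiberOver g b) (2 * 2) 2 2 ((σ b).clsAt (hpt b)) ∧
          ∃ (S' : SchemeOver ℂ) (_ : IsK3Surface S') (_ : fiberOver g b ≅ S' ⊗ S'),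
            3 ≤ Module.finrank ℂ ↥(algebraicClasses S' 1) ∧
            Module.finrank ℂ ↥(algebraicClasses S' 1) < Module.finrank ℂ ↥(algebraicClasses S 1))

/-- The Picard numbers `3` and `5` are not real-multiplication ranks: `e · m + ρ ≠ 22` for `e ≥ 2`,
`m ≥ 3` (`19` and `17` are prime). [cite: Vangeemen2008, Lemma 3.2] -/
theorem not_rmRank_of_lt_eight_of_ne {ρ : ℕ} (h3 : 3 ≤ ρ) (h8 : ρ < 8) (h4 : ρ ≠ 4) (h6 : ρ ≠ 6)
    (h7 : ρ ≠ 7) : ∀ e m : ℕ, 2 ≤ e → 3 ≤ m → e * m + ρ ≠ 22 := by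
  intro e m he hm
  have hρ : ρ = 3 ∨ ρ = 5 := by omega
  rcases hρ with rfl | rfl
  · exact mul_add_ne_of_lt_six_or_prime he hm (Or.inr (by norm_num)) (by norm_num)
  · exact mul_add_ne_of_lt_six_or_prime he hm (Or.inr (by norm_num)) (by norm_num)

/-- **The arithmetic of the ascent (memo NL-ASCENT §1).** For a real-multiplication type `(ρ, d, m)`
— `22 − ρ = d · m`, `[E:ℚ] = d ≥ 2`, `dim_E T = m ≥ 3` — with `ρ ≥ 3`: EITHER `ρ ≥ d + 4` (the
Hasse–Minkowski threshold at which an `E`-trace form of rank `d` embeds in `h^⊥ ⊂ NS(S)_ℚ`, so that `S`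
is a Noether–Lefschetz point of a type-`(ρ − d, d, m + 1)` family), OR `(ρ, d)` is one of the five
TERMINAL pairs `(4,2), (4,3), (6,4), (7,5), (4,6)` (types `(4,2,9), (4,3,6), (6,4,4), (7,5,3), (4,6,3)`).
In particular every type with `ρ ≥ 8` ascends. [cite: GeemenSchutt2023, §2.6 and §3.4]
[cite: Vangeemen2008, Lemma 3.2] -/
theorem four_add_le_or_terminal {ρ d m : ℕ} (h3 : 3 ≤ ρ) (hd : 2 ≤ d) (hm : 3 ≤ m)
    (h : d * m + ρ = 22) :
    d + 4 ≤ ρ ∨ (ρ, d) ∈ ({(4, 2), (4, 3), (6, 4), (7, 5), (4, 6)} : Finset (ℕ × ℕ)) := by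
  have hρ : ρ ≤ 16 := by nlinarith
  have hd' : d ≤ 9 := by nlinarith
  simp only [Finset.mem_insert, Finset.mem_singleton, Prod.mk.injEq]
  interval_cases ρ <;> interval_cases d <;> omega

/-- Hence **at `ρ ≥ 8` every real-multiplication type ascends** (`ρ ≥ d + 4`), and the ascent lands at
Picard number `ρ − d ≥ 4`. [cite: GeemenSchutt2023, §2.6 and §3.4] -/
theorem four_add_le_of_eight_le {ρ d m : ℕ} (h8 : 8 ≤ ρ) (hd : 2 ≤ d) (hm : 3 ≤ m)
    (h : d * m + ρ = 22) : d + 4 ≤ ρ := by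
  rcases four_add_le_or_terminal (by omega) hd hm h with h' | h'
  · exact h'
  · simp only [Finset.mem_insert, Finset.mem_singleton, Prod.mk.injEq] at h'
    omega

/-- **HC⁴ for every K3 square with `ρ(S) ≥ 3`, from Buskin, markings, the displayed Noether–Lefschetz
ascent families at `ρ ≥ 8`, and HC⁴ for the non-CM non-scalar K3 squares at `ρ ∈ {4, 6, 7}`** — strong
induction on the Picard number: off the real-multiplication ranks by
`hodgeConjectureFor_square_of_forall_mul_add_ne`; CM by `CMThird.hodgeConjectureFor_square_of_CM_of_buskin`;
`End_Hdg(T) = ℚ` by the kernel theorem; at `ρ ∈ {4,6,7}` by `hTerm`; at `ρ ≥ 8` the ascent family's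
residual fibres are K3 squares of smaller Picard number `≥ 3`, where the induction hypothesis gives HC⁴
(transported along `𝒳_b ≅ S' ⊗ S'`), so `NSAbsorption.hodgeConjectureFor_square_of_residual_hodgeConjectureFor_of_section`
concludes. [cite: GeemenSchutt2023, §2.6, Prop. 3.2 and §3.4] [cite: VoisinHodgeII2003, §7.3.2]
[cite: Buskin2019, Thm. 1.1] [cite: Varesco2023, §2 (p. 8)] -/
theorem hodgeConjectureFor_square_of_nlAscent (hB : Buskin2019_hodgeIsometry_algebraic)
    (hmark : Huybrechts_K3_marking_exists)
    (hAsc : ∀ (S : SchemeOver ℂ) (hS : IsK3Surface S), ¬ HasComplexMultiplication S →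
      8 ≤ Module.finrank ℂ ↥(algebraicClasses S 1) →
      (∃ e m : ℕ, 2 ≤ e ∧ 3 ≤ m ∧ e * m + Module.finrank ℂ ↥(algebraicClasses S 1) = 22) →
      ¬ Scalar[S] → NLAscentFamily[S, hS.isSmoothProjective])
    (hTerm : ∀ (S : SchemeOver ℂ) (hS : IsK3Surface S), ¬ HasComplexMultiplication S →
      (Module.finrank ℂ ↥(algebraicClasses S 1) = 4 ∨ Module.finrank ℂ ↥(algebraicClasses S 1) = 6 ∨
        Module.finrank ℂ ↥(algebraicClasses S 1) = 7) →
      ¬ Scalar[S] → HodgeConjectureFor 4 (S ⊗ S))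
    (k : ℕ) : ∀ (S : SchemeOver ℂ) (hS : IsK3Surface S),
      Module.finrank ℂ ↥(algebraicClasses S 1) = k → 3 ≤ k → HodgeConjectureFor 4 (S ⊗ S) := by
  induction k using Nat.strong_induction_on with
  | _ k ih =>
  intro S hS hk h3
  by_cases hem : ∃ e m : ℕ, 2 ≤ e ∧ 3 ≤ m ∧ e * m + Module.finrank ℂ ↥(algebraicClasses S 1) = 22
  swap
  · push Not at hem
    exact hodgeConjectureFor_square_of_forall_mul_add_ne hB hmark hS fun e m he hm => hem e m he hm
  by_cases hCM : HasComplexMultiplication S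
  · exact CMThird.hodgeConjectureFor_square_of_CM_of_buskin hB hmark S hS hCM
  by_cases hQ : Scalar[S]
  · exact SquareGlueFree.hodgeConjectureFor_square_of_hodgeEndomorphisms_scalar hS.isSmoothProjective hQ
  by_cases h8 : 8 ≤ Module.finrank ℂ ↥(algebraicClasses S 1)
  · -- ascent: the residual fibres are K3 squares of smaller Picard number `≥ 3`
    obtain ⟨t, f, ht_rat, ht_N, hgen, hfN, hfT, 𝒳, B, g, hg, h𝒳, hBq, hBsm, hirr, σ, hpt, hσ, b₁, e₁,
      hind, hres⟩ := hAsc S hS hCM h8 hem hQ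
    haveI := hirr
    refine NSAbsorption.hodgeConjectureFor_square_of_residual_hodgeConjectureFor_of_section
      hS.isSmoothProjective t ht_rat ht_N hgen f hfN hfT g hg h𝒳 hBq hBsm σ hσ hpt ?_ ?_ ?_ b₁ e₁ hind
    · filter_upwards [hres] with b hb
      obtain ⟨-, -, S', hS', e', h3', hlt⟩ := hb
      have hlt' : Module.finrank ℂ ↥(algebraicClasses S' 1) < k := hk ▸ hlt
      exact (hodgeConjectureFor_iff_of_iso' e').2 (ih _ hlt' S' hS' rfl h3')
    · filter_upwards [hres] with b hb
      exact hb.1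
    · filter_upwards [hres] with b hb
      exact hb.2.1
  · -- terminal Picard numbers `4, 6, 7` (`3`, `5` are not real-multiplication ranks)
    have hk8 : Module.finrank ℂ ↥(algebraicClasses S 1) < 8 := by omega
    by_cases h467 : Module.finrank ℂ ↥(algebraicClasses S 1) = 4 ∨
        Module.finrank ℂ ↥(algebraicClasses S 1) = 6 ∨ Module.finrank ℂ ↥(algebraicClasses S 1) = 7
    · exact hTerm S hS hCM h467 hQ
    · exfalso
      obtain ⟨e, m, he, hm, hsum⟩ := hem
      have h3' : 3 ≤ Module.finrank ℂ ↥(algebraicClasses S 1) := hk ▸ h3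
      exact not_rmRank_of_lt_eight_of_ne h3' hk8 (fun h => h467 (Or.inl h))
        (fun h => h467 (Or.inr (Or.inl h))) (fun h => h467 (Or.inr (Or.inr h))) e m he hm hsum

/-- **Crux `PicardThreeK3Squares` modulo the Noether–Lefschetz ascent**: granted Buskin's Thm. 1.1,
the existence of markings, the displayed ascent families for the non-CM non-scalar K3 surfaces in the
real-multiplication ranks with `ρ ≥ 8` (a theorem of moduli theory, input (I1′) of the crux dossier —
not constructed in the tree), and HC⁴ for the non-CM non-scalar K3 squares with `ρ(S) ∈ {4, 6, 7}`
(OPEN: the five terminal real-multiplication types and the two ascendable ones at `ρ = 6, 7`), the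
route item `PicardThreeK3Squares` holds. The open content of crux #4 is thereby located at Picard
numbers `4, 6, 7` only. [cite: GeemenSchutt2023, §2.6, Prop. 3.2 and §3.4] [cite: VoisinHodgeII2003, §7.3.2]
[cite: Buskin2019, Thm. 1.1] [cite: Varesco2023, §2 (p. 8)] -/
theorem picardThreeK3Squares_of_nlAscent (hB : Buskin2019_hodgeIsometry_algebraic)
    (hmark : Huybrechts_K3_marking_exists)
    (hAsc : ∀ (S : SchemeOver ℂ) (hS : IsK3Surface S), ¬ HasComplexMultiplication S →
      8 ≤ Module.finrank ℂ ↥(algebraicClasses S 1) →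
      (∃ e m : ℕ, 2 ≤ e ∧ 3 ≤ m ∧ e * m + Module.finrank ℂ ↥(algebraicClasses S 1) = 22) →
      ¬ Scalar[S] → NLAscentFamily[S, hS.isSmoothProjective])
    (hTerm : ∀ (S : SchemeOver ℂ) (hS : IsK3Surface S), ¬ HasComplexMultiplication S →
      (Module.finrank ℂ ↥(algebraicClasses S 1) = 4 ∨ Module.finrank ℂ ↥(algebraicClasses S 1) = 6 ∨
        Module.finrank ℂ ↥(algebraicClasses S 1) = 7) →
      ¬ Scalar[S] → HodgeConjectureFor 4 (S ⊗ S)) :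
    Summit.HodgeConjecture.HodgeConjecture.Theses.MarkmanPartnerTransport.PicardThreeK3Squares := by
  intro S hS η p x _ hρ
  exact hodgeConjectureFor_square_of_nlAscent hB hmark hAsc hTerm _ S hS rfl hρ

/-! ### The sharp form: the five terminal real-multiplication TYPES -/

/-- `Terminal[S]`: **`S` has real multiplication of a TERMINAL type** — there is a rational,
type-preserving endomorphism `t` of `H²(S(ℂ); ℂ)` killing `N¹`, with image cup-orthogonal to `N¹`,
generating the rational Hodge endomorphisms of `T(S)` (`TranscendentalEndomorphismsGeneratedBy S t`) and
annihilated on `T(S)` by an IRREDUCIBLE rational polynomial `P` (so `E = End_Hdg(T(S)_ℚ) ≅ ℚ[X]/(P)`,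
`[E:ℚ] = deg P`), such that `(ρ(S), deg P)` is one of `(4,2), (4,3), (6,4), (7,5), (4,6)` — the types
`(4,2,9), (4,3,6), (6,4,4), (7,5,3), (4,6,3)` of the memo NL-ASCENT. Local notation only (an
`∃`-statement, not a definition). [cite: GeemenSchutt2023, §2.1 and §3.4] -/
local notation3 (prettyPrint := false) "Terminal[" S "]" =>
  (∃ (t : complexBetti S (2 * 1) →ₗ[ℂ] complexBetti S (2 * 1)) (P : ℚ[X]),
    (∀ y, IsRationalClass y → IsRationalClass (t y)) ∧
    (∀ (i j : ℕ) (y : complexBetti S (2 * 1)),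
      IsOfHodgeType 2 S (2 * 1) i j y → IsOfHodgeType 2 S (2 * 1) i j (t y)) ∧
    (∀ d ∈ algebraicClasses S 1, t d = 0) ∧
    (∀ (y : complexBetti S (2 * 1)), ∀ d ∈ algebraicClasses S 1,
      cupProduct (rfl : 2 * 1 + 2 * 1 = 2 * 2) (t y) d = 0) ∧
    Irreducible P ∧ IsAnnihilatedOnTranscendentalBy S t P ∧ TranscendentalEndomorphismsGeneratedBy S t ∧
    (Module.finrank ℂ ↥(algebraicClasses S 1), P.natDegree) ∈
      ({(4, 2), (4, 3), (6, 4), (7, 5), (4, 6)} : Finset (ℕ × ℕ)))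

/-- **HC⁴ for every K3 square with `ρ(S) ≥ 3` — sharp form of the ascent**: GRANTED Buskin, markings,
the displayed Noether–Lefschetz ascent families for every non-CM, non-scalar K3 surface in the
real-multiplication ranks that is NOT of terminal type (for such `S` the field degree `d` satisfies
`ρ(S) ≥ d + 4`, `four_add_le_or_terminal`, and the ascent family exists — memo NL-ASCENT §2; moduli input
(I1′), not constructed in the tree), and HC⁴(`S ⊗ S`) for the K3 surfaces of TERMINAL type
(`Terminal[S]`, OPEN): strong induction on the Picard number as in `hodgeConjectureFor_square_of_nlAscent`.
[cite: GeemenSchutt2023, §2.6, Prop. 3.2 and §3.4] [cite: VoisinHodgeII2003, §7.3.2]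
[cite: Buskin2019, Thm. 1.1] [cite: Varesco2023, §2 (p. 8)] -/
theorem hodgeConjectureFor_square_of_nlAscent_terminal (hB : Buskin2019_hodgeIsometry_algebraic)
    (hmark : Huybrechts_K3_marking_exists)
    (hAsc : ∀ (S : SchemeOver ℂ) (hS : IsK3Surface S), ¬ HasComplexMultiplication S →
      3 ≤ Module.finrank ℂ ↥(algebraicClasses S 1) →
      (∃ e m : ℕ, 2 ≤ e ∧ 3 ≤ m ∧ e * m + Module.finrank ℂ ↥(algebraicClasses S 1) = 22) →
      ¬ Scalar[S] → ¬ Terminal[S] → NLAscentFamily[S, hS.isSmoothProjective])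
    (hTerm : ∀ (S : SchemeOver ℂ) (hS : IsK3Surface S), ¬ HasComplexMultiplication S → ¬ Scalar[S] →
      Terminal[S] → HodgeConjectureFor 4 (S ⊗ S))
    (k : ℕ) : ∀ (S : SchemeOver ℂ) (hS : IsK3Surface S),
      Module.finrank ℂ ↥(algebraicClasses S 1) = k → 3 ≤ k → HodgeConjectureFor 4 (S ⊗ S) := by
  induction k using Nat.strong_induction_on with
  | _ k ih =>
  intro S hS hk h3
  by_cases hem : ∃ e m : ℕ, 2 ≤ e ∧ 3 ≤ m ∧ e * m + Module.finrank ℂ ↥(algebraicClasses S 1) = 22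
  swap
  · push Not at hem
    exact hodgeConjectureFor_square_of_forall_mul_add_ne hB hmark hS fun e m he hm => hem e m he hm
  by_cases hCM : HasComplexMultiplication S
  · exact CMThird.hodgeConjectureFor_square_of_CM_of_buskin hB hmark S hS hCM
  by_cases hQ : Scalar[S]
  · exact SquareGlueFree.hodgeConjectureFor_square_of_hodgeEndomorphisms_scalar hS.isSmoothProjective hQ
  by_cases hT : Terminal[S]
  · exact hTerm S hS hCM hQ hT
  · obtain ⟨t, f, ht_rat, ht_N, hgen, hfN, hfT, 𝒳, B, g, hg, h𝒳, hBq, hBsm, hirr, σ, hpt, hσ, b₁, e₁,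
      hind, hres⟩ := hAsc S hS hCM (hk ▸ h3) hem hQ hT
    haveI := hirr
    refine NSAbsorption.hodgeConjectureFor_square_of_residual_hodgeConjectureFor_of_section
      hS.isSmoothProjective t ht_rat ht_N hgen f hfN hfT g hg h𝒳 hBq hBsm σ hσ hpt ?_ ?_ ?_ b₁ e₁ hind
    · filter_upwards [hres] with b hb
      obtain ⟨-, -, S', hS', e', h3', hlt⟩ := hb
      have hlt' : Module.finrank ℂ ↥(algebraicClasses S' 1) < k := hk ▸ hlt
      exact (hodgeConjectureFor_iff_of_iso' e').2 (ih _ hlt' S' hS' rfl h3')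
    · filter_upwards [hres] with b hb
      exact hb.1
    · filter_upwards [hres] with b hb
      exact hb.2.1

/-- **Crux `PicardThreeK3Squares` modulo the Noether–Lefschetz ascent — sharp form**: granted Buskin's
Thm. 1.1, markings and the displayed ascent families for the non-terminal real-multiplication K3
surfaces (a theorem of moduli theory: input (I1′)), the route item `PicardThreeK3Squares` FOLLOWS FROM
the Hodge conjecture for the squares of the K3 surfaces of the five TERMINAL real-multiplication types
`(ρ, [E:ℚ], dim_E T) ∈ {(4,2,9), (4,3,6), (6,4,4), (7,5,3), (4,6,3)}` — the very general members of the
largest real-multiplication families (dimensions `7, 4, 2, 1, 1`). This is where the open content of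
crux #4 lives. [cite: GeemenSchutt2023, §2.6, Prop. 3.2 and §3.4] [cite: VoisinHodgeII2003, §7.3.2]
[cite: Buskin2019, Thm. 1.1] [cite: Varesco2023, §2 (p. 8)] -/
theorem picardThreeK3Squares_of_nlAscent_terminal (hB : Buskin2019_hodgeIsometry_algebraic)
    (hmark : Huybrechts_K3_marking_exists)
    (hAsc : ∀ (S : SchemeOver ℂ) (hS : IsK3Surface S), ¬ HasComplexMultiplication S →
      3 ≤ Module.finrank ℂ ↥(algebraicClasses S 1) →
      (∃ e m : ℕ, 2 ≤ e ∧ 3 ≤ m ∧ e * m + Module.finrank ℂ ↥(algebraicClasses S 1) = 22) →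
      ¬ Scalar[S] → ¬ Terminal[S] → NLAscentFamily[S, hS.isSmoothProjective])
    (hTerm : ∀ (S : SchemeOver ℂ) (hS : IsK3Surface S), ¬ HasComplexMultiplication S → ¬ Scalar[S] →
      Terminal[S] → HodgeConjectureFor 4 (S ⊗ S)) :
    Summit.HodgeConjecture.HodgeConjecture.Theses.MarkmanPartnerTransport.PicardThreeK3Squares := by
  intro S hS η p x _ hρ
  exact hodgeConjectureFor_square_of_nlAscent_terminal hB hmark hAsc hTerm _ S hS rfl hρ

end Summit.HodgeConjecture.HodgeConjecture.Theorems.MarkmanPartnerTransport.NLAscent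

end
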